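import Mathlib.MeasureTheory.Group.Measure
import Mathlib.Analysis.Complex.Basic
import HarnessLib

/-!
# F0 · P3c · line LH6 «StCharTS» — road (D) «DEEP-FL», (D-c)(δ₄-core) «VALUE ALGEBRA»: the finite-sum bookkeeping behind `VALUE_H = VALUE_G`
# [Rogawski1990, §12.7 Lemma 12.7.3 p. 195 («`D_G χ^G_ρ(γ) = ξ(γ)μ(α)‖α‖^{1∕2}`»); §4.9 Lemma 4.9.2 p. 56]

Cell `pub/hodgecm-mathlib`, crux H413 = `stmt-HodgeConjecture-24833` (lane `--supports … --as helper`), route HCCMUnconditional; seat LH6-p02 (g2); road (D) owner LH6-p04 (g3)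
(from 06:21:20Z; ROAD-D v6 `F0/P3b/LH6-p03/g0/ROAD-D.status.v6.txt` ee6dbfab8110b31e, (D-c)(δ) «VALUE-IDENTITY» → LH6-p02; census `F0/P3b/LH6-p02/g2/CENSUS-VALUE-IDENTITY.v1.md`).
THEOREMS ONLY, sorry-free, Mathlib-only; no definition ∕ instance ∕ notation ∕ named fact.  HONEST LABEL: HC_CM is proved only modulo the 7 printed citations (2 remaining:
hLiu418 = stmt-HodgeConjecture-24832, h413 = stmt-HodgeConjecture-24833) until rung 0 closes; count-neutral (D-c) bookkeeping, closes nothing by itself.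

THE MATHEMATICS (census §2–§3).  The explicit transfer of road (D) is `f^H₀ = Σ_{j∈F} c_j·𝟙_{K_H u_j K_H}` over coset representatives `u_j` of the deep shell `b·S_n = ⨆_j u_j·S′`,
with `c_j = τ_j·κ_G∕κ_{H,j}` (★ p849750, (Q1)), `κ_G = A_G·r_G`, `κ_{H,j} = A_{H,j}·r_H` (the D3-ii constants: `A_G = ν(K_n)·#R·δ_B^{1∕2}(b)`, `A_{H,j} =
ν₂(K_{2,n′})·#R_{2,j}·ν₁(K₁)·δ_{B₂}^{1∕2}(u_j)`, `r_G = μT(S_v)∕μT(S_n)`, `r_H = μT(S_{H,v})∕μT(S′)`), per-summand traces `Tr πSt(𝟙_j) = A_{H,j}·Θ_j` (★ HSt + ★ F1-H + ★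
`F0P3cStCharTSXiOnTorus.xi_kill`), `τ_j·Θ_j = χ_ξ(u_j)` (★ (L2) `torusCharPair_mul_localDet_mul_finTau_eq_cmXiTorusChar`) `= χ_ξ(b)` (`χ_ξ` trivial on `S_n`), and
`|F|·μT(S′) = μT(S_n)`, `S_v = S_{H,v}`.  Then — THIS FILE, pure algebra in `ℂ` over an abstract index set —
  `VALUE_H = Σ_j c_j·Tr πSt(𝟙_j) = Σ_j τ_jΘ_j · A_G·r_G∕r_H = |F|·χ_ξ(b)·A_G·r_G∕r_H = A_G·χ_ξ(b) = VALUE_G`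
(`sum_coeff_mul_trace_eq_value`), plus the two group-theoretic inputs in generic form: a character is constant on a coset of a subgroup it kills
(`map_mul_eq_of_mem_of_forall`), and the Haar count `|F|·μ(S′) = μ(S)` for a finite disjoint coset cover `b·S = ⨆_j u_j·S′` (`card_mul_measure_eq_of_cover`).

## References
* [Rogawski1990] J. D. Rogawski, *Automorphic Representations of Unitary Groups in Three Variables*, Ann. of Math. Stud. 123 (1990): §12.7 Lemma 12.7.3 p. 195; §4.9 Lemma
  4.9.2 p. 56; Prop. 4.9.1 p. 55.
-/

set_option autoImplicit false
-- the mandated namespace has the single-problem summit's repeated segment (`HodgeConjecture.HodgeConjecture`)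
set_option linter.dupNamespace false

open MeasureTheory
open scoped Pointwise

namespace Summit.HodgeConjecture.HodgeConjecture.Cruxes.H413.F0P3cStCharTSValueAlgebra

/-! ## §1 The finite sum in `ℂ` -/

/-- One summand: `c_j · Tr_j = (τ_j·(A_G r_G)∕(A_j r_H)) · (A_j·Θ_j) = (τ_jΘ_j)·A_G·r_G∕r_H` — the per-summand constant `A_j` (with its `#R_{2,j}`, `ν₂`, `ν₁`,
`δ_{B₂}^{1∕2}(u_j)`) CANCELS. [cite: Rogawski1990, §12.7 Lemma 12.7.3 p. 195] -/
theorem coeff_mul_trace_eq (τ Θ A AG rG rH : ℂ) (hA : A ≠ 0) (hrH : rH ≠ 0) :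
    τ * (AG * rG) / (A * rH) * (A * Θ) = τ * Θ * (AG * rG / rH) := by
  field_simp

/-- **«VALUE ALGEBRA»**: with `c_j = τ_j·(A_G r_G)∕(A_j r_H)`, `Tr_j = A_j·Θ_j`, `τ_j·Θ_j = χ` for every `j ∈ F` and the Haar count `|F|·r_G = r_H` (`r_G∕r_H = |F|⁻¹`),
`Σ_{j∈F} c_j·Tr_j = A_G·χ` — `VALUE_H = VALUE_G` of ROAD-D v6 CHANGE 2 once the ★ inputs are plugged (census §3). [cite: Rogawski1990, §12.7 Lemma 12.7.3 p. 195] -/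
theorem sum_coeff_mul_trace_eq_value {ι : Type*} (F : Finset ι) (τ Θ A : ι → ℂ) (AG rG rH χ : ℂ)
    (hA : ∀ j ∈ F, A j ≠ 0) (hrH : rH ≠ 0) (hχ : ∀ j ∈ F, τ j * Θ j = χ) (hcard : (F.card : ℂ) * rG = rH) :
    ∑ j ∈ F, τ j * (AG * rG) / (A j * rH) * (A j * Θ j) = AG * χ := by
  have h1 : ∑ j ∈ F, τ j * (AG * rG) / (A j * rH) * (A j * Θ j) = ∑ j ∈ F, χ * (AG * rG / rH) := by
    refine Finset.sum_congr rfl fun j hj => ?_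
    rw [coeff_mul_trace_eq _ _ _ _ _ _ (hA j hj) hrH, hχ j hj]
  rw [h1, Finset.sum_const, nsmul_eq_mul]
  by_cases hrG : rG = 0
  · exfalso; rw [hrG, mul_zero] at hcard; exact hrH hcard.symm
  · have hF : (F.card : ℂ) = rH / rG := by field_simp; linear_combination hcard
    rw [hF]; field_simp

/-- The same with the coefficients given abstractly: `c_j·A_j·r_H = τ_j·A_G·r_G` (the orbital matching, ★ p849750 ∕ (Q1), cleared of denominators).
[cite: Rogawski1990, §4.9 Lemma 4.9.2 p. 56; §12.7 Lemma 12.7.3 p. 195] -/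
theorem sum_coeff_mul_trace_eq_value' {ι : Type*} (F : Finset ι) (c τ Θ A : ι → ℂ) (AG rG rH χ : ℂ)
    (hrH : rH ≠ 0) (hc : ∀ j ∈ F, c j * (A j * rH) = τ j * (AG * rG)) (hχ : ∀ j ∈ F, τ j * Θ j = χ) (hcard : (F.card : ℂ) * rG = rH) :
    ∑ j ∈ F, c j * (A j * Θ j) = AG * χ := by
  have h1 : ∑ j ∈ F, c j * (A j * Θ j) = ∑ j ∈ F, χ * (AG * rG / rH) := by
    refine Finset.sum_congr rfl fun j hj => ?_
    have := hc j hj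
    calc c j * (A j * Θ j) = (c j * (A j * rH)) * Θ j / rH := by field_simp
      _ = τ j * (AG * rG) * Θ j / rH := by rw [this]
      _ = χ * (AG * rG / rH) := by rw [← hχ j hj]; field_simp
  rw [h1, Finset.sum_const, nsmul_eq_mul]
  by_cases hrG : rG = 0
  · exfalso; rw [hrG, mul_zero] at hcard; exact hrH hcard.symm
  · have hF : (F.card : ℂ) = rH / rG := by field_simp; linear_combination hcard
    rw [hF]; field_simp

/-! ## §2 The two group-theoretic inputs, generic -/

/-- **A character is constant on a coset of a subgroup it kills**: `χ(b·s) = χ(b)` for `s ∈ S`, `χ|_S = 1` ((R5): `χ_ξ(u_j) = χ_ξ(b)` on the shell `b·S_n` once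
`S_n ≤ ker χ_ξ`, the XIG `∃ U ∈ 𝓝 1` clause). [cite: Rogawski1990, §12.7 Lemma 12.7.3 p. 195] -/
theorem map_mul_eq_of_mem_of_forall {T M : Type*} [Group T] [Monoid M] (χ : T →* M) (S : Subgroup T) (hS : ∀ s ∈ S, χ s = 1)
    (b s : T) (hs : s ∈ S) : χ (b * s) = χ b := by
  rw [map_mul, hS s hs, mul_one]

/-- The same keyed on membership in the coset: `u ∈ b • S` (as a set) ⇒ `χ u = χ b`. [cite: Rogawski1990, §12.7 Lemma 12.7.3 p. 195] -/
theorem map_eq_of_mem_smul {T M : Type*} [Group T] [Monoid M] (χ : T →* M) (S : Subgroup T) (hS : ∀ s ∈ S, χ s = 1)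
    {b u : T} (hu : u ∈ b • (S : Set T)) : χ u = χ b := by
  obtain ⟨s, hs, rfl⟩ := Set.mem_smul_set.1 hu
  exact map_mul_eq_of_mem_of_forall χ S hS b s hs

/-- **The Haar count of a finite disjoint coset cover**: if `b • S = ⋃_{j∈F} u_j • S′` with the `u_j • S′` pairwise disjoint and `S′` measurable, then for every
left-invariant measure `μ`, `|F| · μ(S′) = μ(S)` ((R4)(iii): `|F| = μT(S_n)∕μT(S′)`). [cite: Rogawski1990, §12.7 Lemma 12.7.3 p. 195] -/
theorem card_mul_measure_eq_of_cover {T : Type*} [Group T] [MeasurableSpace T] [MeasurableMul T] (μ : Measure T) [μ.IsMulLeftInvariant]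
    {ι : Type*} (F : Finset ι) (u : ι → T) (S S' : Set T) (hS' : MeasurableSet S') (b : T)
    (hcover : b • S = ⋃ j ∈ F, u j • S') (hdisj : (F : Set ι).PairwiseDisjoint fun j => u j • S') :
    (F.card : ENNReal) * μ S' = μ S := by
  have hS : μ S = μ (b • S) := (measure_smul μ b S).symm
  rw [hS, hcover, measure_biUnion_finset hdisj fun j _ => hS'.const_smul (u j)]
  simp_rw [measure_smul]
  rw [Finset.sum_const, nsmul_eq_mul]

end Summit.HodgeConjecture.HodgeConjecture.Cruxes.H413.F0P3cStCharTSValueAlgebra
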